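import Summits.HodgeConjecture.HodgeConjecture.Theorems.F0P3cStCharTSDGField      -- ★ p851395 (F0P3-p02 (g20)) «DG-FIELD★»: the closed form `dg`, `dgFormula_eq_of_unit_rel`, `dgFormula_eq_zero_of_not_isUnit_discr`, `exists_unit_rel_iff_isUnit_discr`
import HarnessLib

/-!
# F0 · P3c · line LH6 «StCharTS» — «DG-REG★» (datum road, rider to ★ «DG-FIELD★» D5): the Weyl-discriminant field `𝔇.DG` VANISHES EXACTLY OFF `G^{reg}`, is POSITIVE
# EXACTLY ON `G^{reg}`, and is a CLASS FUNCTION — print's conventions for `D_G` as theorems [Rogawski1990, §3.1 p. 19; §4.9 p. 54; §12.5 p. 182]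

Cell `pub/hodgecm-mathlib`, crux H413 = `stmt-HodgeConjecture-24833` (lane `--supports … --as helper`), route HCCMUnconditional; seat F0P3a-p03 (g23); rider to the datum-road slice
«DG-FIELD★» (★ `F0P3cStCharTSDGField`, F0P3-p02 (g20); map owner LH6-p01 (g4), PLAN S9 §1 D5 «`DG γ := √√‖discr(charpoly γ) ∕ det(γ)²‖` (0 at non-regular `γ`)»).
THEOREMS ONLY (no definition ∕ instance ∕ notation ∕ named fact ∕ `sorry`); ★-only imports.

WHAT.  ★ «DG-FIELD★» pins `𝔇.DG` by the field equation `hDG : ∀ g, 𝔇.DG g = dg(g)`, `dg(g) = √√(N(discr(charpoly g)) · N(det g)⁻²)`, `N(x) = Π_{w ∣ v} |x_w|_w`, and proves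
«non-unit discriminant ⇒ `dg = 0`» and the Harish-Chandra junction.  This rider adds the BRIDGE TO THE ORGAN'S REGULARITY TOKEN `IsRegularElt` (= «`charpoly` separable»,
★ `LocalTransfer`; COMPAT `hreg : γ ∈ 𝔇.regG ↔ IsRegularElt γ`) and the two print conventions the slices use silently:
* §1 `isUnit_charpoly_discr_iff_isRegularElt` — **`discr(charpoly g)` is a unit of `L ⊗ L⁺_v` iff `g` is regular** (for a MONIC polynomial over any commutative ring,
  `IsUnit (discr f) ↔ f` separable: Mathlib `resultant_deriv` + `isUnit_resultant_iff_isCoprime` + `separable_def`); hence `exists_unit_rel_iff_isRegularElt` (the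
  Harish-Chandra antecedent `∃ u, u·det(g)² = discr` is inhabited iff `g ∈ G^{reg}`);
* §2 on the closed form: `dgFormula_ne_zero_of_isRegularElt`, **`dgFormula_eq_zero_iff_not_isRegularElt`** (D5's «0 at non-regular `γ`» is an IFF), `dgFormula_pos_iff_isRegularElt`,
  and **`dgFormula_conj`** (`dg(h g h⁻¹) = dg(g)`: `discr ∘ charpoly` and `det` are conjugation-invariant);
* §3 at a datum with the field equation (★'s `hDG` text verbatim): **`DG_eq_zero_iff_not_isRegularElt`**, `DG_pos_iff_isRegularElt`, `DG_ne_zero_of_mem_regG` ∕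
  `DG_eq_zero_of_not_mem_regG` (through COMPAT `hreg`), and **`DG_conj`** (`𝔇.DG (h γ h⁻¹) = 𝔇.DG γ`) — what makes `D_G⁻¹` legitimate on `G^{reg}` in the transfer-factor form
  of `α^G` (S13, shape (B)) and `D_G` a class function in the Weyl-integration bookkeeping (p. 182).
HONEST LABEL: HC_CM is proved only modulo the 7 printed citations (2 remaining named inputs: hLiu418 = `stmt-HodgeConjecture-24832`, h413 = `stmt-HodgeConjecture-24833`)
until rung 0 closes; this file closes no organ (count-neutral rider on a constructor-side slice).

## References
* [Rogawski1990] J. D. Rogawski, *Automorphic Representations of Unitary Groups in Three Variables*, Ann. of Math. Stud. 123 (1990): §3.1 p. 19 (regular elements: distinct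
  eigenvalues); §4.9 p. 54 (`D_G(γ) = |Π(1 − α(γ))|^{1∕2}`, non-zero exactly at regular `γ`); §12.5 p. 182 (`D_G` in the Weyl integration formula, a class function on `G^{reg}`).
* [BasuPollackRoy2006] S. Basu, R. Pollack, M.-F. Roy, *Algorithms in Real Algebraic Geometry* (2006), Ch. 4 §4.1 Prop. 4.3 (`Disc(P) = 0` iff `P` has a multiple root).
-/

set_option autoImplicit false
-- the mandated namespace has the single-problem summit's repeated segment (`HodgeConjecture.HodgeConjecture`)
set_option linter.dupNamespace false

noncomputable section

open MeasureTheory Filter Topology Polynomial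
open NumberField IsDedekindDomain
open scoped NNReal Matrix MatrixGroups
open Literature.NumberTheory.Automorphic Literature.NumberTheory.Automorphic.UnitaryGroup
open Literature.NumberTheory.GaloisRepresentations Literature.NumberTheory.GaloisRepresentations.IsNonarchimedeanLocalField
open Literature.NumberTheory.Rogawski1990 Literature.NumberTheory.Rogawski1990.Ch12Sec5

namespace Summit.HodgeConjecture.HodgeConjecture.Cruxes.H413.F0P3cStCharTSDGFieldReg

open F0P3cStCharTSDGField

/-! ## §1 `discr(charpoly g)` is a unit iff `g` is regular -/

section Generic

variable {R : Type*} [CommRing R]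

/-- **`IsUnit (discr f) ↔ f` separable, for every MONIC `f` over a commutative ring** (`Res(f, f′) = ε·lc(f)·discr f`, Mathlib `resultant_deriv` padded to Mathlib's default
Sylvester sizes by `resultant_add_right_deg`; `IsUnit (Res(f, g)) ↔ IsCoprime f g` for monic `f`; `separable_def`).  This is ★
`Literature.LinearAlgebra.Matrix.isUnit_discr_iff_separable_of_monic` (`CharpolyDiscTwinBridge`), reproduced PRIVATELY to keep this file's import closure inside the
datum road's built closure (that module's olean is not served on the farm today); cite the ★ name, not this copy. [cite: BasuPollackRoy2006, Ch. 4 §4.1 Prop. 4.3] -/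
private theorem isUnit_discr_iff_separable_of_monic' {f : R[X]} (hf : f.Monic) : IsUnit f.discr ↔ f.Separable := by
  have hres : resultant f (derivative f) = (-1) ^ (f.natDegree * (f.natDegree - 1) / 2) * f.discr := by
    have h1 : resultant f (derivative f) f.natDegree (f.natDegree - 1) = (-1) ^ (f.natDegree * (f.natDegree - 1) / 2) * f.discr := by
      by_cases h0 : f.natDegree = 0
      · have h1 : f = 1 := eq_one_of_monic_natDegree_zero hf h0
        subst h1
        have hd : discr (1 : R[X]) = 1 := by simpa using discr_C (1 : R)
        simp [hd]
      · rw [resultant_deriv (natDegree_pos_iff_degree_pos.mp (Nat.pos_of_ne_zero h0)), hf.leadingCoeff, mul_one]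
    rw [← h1]
    obtain ⟨k, hk⟩ : ∃ k, f.natDegree - 1 = (derivative f).natDegree + k :=
      ⟨f.natDegree - 1 - (derivative f).natDegree, by have := natDegree_derivative_le f; omega⟩
    rw [hk, resultant_add_right_deg _ _ _ _ _ le_rfl]
    by_cases h0 : f.natDegree = 0
    · have h1 : f = 1 := eq_one_of_monic_natDegree_zero hf h0
      subst h1; simp
    · rw [coeff_natDegree, hf.leadingCoeff, one_pow, one_mul]
  rw [separable_def, ← isUnit_resultant_iff_isCoprime hf, hres, IsUnit.mul_iff]
  have hu : IsUnit ((-1 : R) ^ (f.natDegree * (f.natDegree - 1) / 2)) := (isUnit_one.neg).pow _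
  exact ⟨fun h => ⟨hu, h⟩, fun h => h.2⟩

/-- `discr ∘ charpoly` is a class function: `discr(charpoly (g x g⁻¹)) = discr(charpoly x)`. [cite: Rogawski1990, §3.1 p. 19] -/
theorem charpoly_discr_units_conj {n : Type*} [Fintype n] [DecidableEq n] (g : GL n R) (x : Matrix n n R) :
    (g.val * x * g⁻¹.val).charpoly.discr = x.charpoly.discr := by
  rw [Matrix.coe_units_inv, Matrix.charpoly_units_conj]

end Generic

section Gqs

variable (L : Type) [Field L] [NumberField L] [IsCMField L] (v : HeightOneSpectrum (𝓞 ↥(maximalRealSubfield L)))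

/-- **`discr(charpoly g)` IS A UNIT of `L ⊗ L⁺_v` IFF `g ∈ U(Φ₃)(L⁺_v)` IS REGULAR** (`IsRegularElt` = «`charpoly` separable», ★ `LocalTransfer`; any finite place `v`).
[cite: Rogawski1990, §3.1 p. 19; §4.9 p. 54] -/
theorem isUnit_charpoly_discr_iff_isRegularElt (g : Gqs L v) :
    IsUnit ((g.val : GL (Fin 3) (UnitaryGroup.LocalRing L v)).val.charpoly.discr) ↔ IsRegularElt (g.val : GL (Fin 3) (UnitaryGroup.LocalRing L v)) :=
  isUnit_discr_iff_separable_of_monic' (Matrix.charpoly_monic _)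

/-- **The Harish-Chandra antecedent is inhabited iff `g` is regular**: `(∃ u, u·det(g)² = discr(charpoly g)) ↔ g ∈ G^{reg}` (★ `exists_unit_rel_iff_isUnit_discr` ∘ §1).
[cite: Rogawski1990, §4.9 p. 54] -/
theorem exists_unit_rel_iff_isRegularElt (g : Gqs L v) :
    (∃ u : (UnitaryGroup.LocalRing L v)ˣ, (u : UnitaryGroup.LocalRing L v) * ((g.val : GL (Fin 3) (UnitaryGroup.LocalRing L v)).val.det) ^ (3 - 1) =
        ((g.val : GL (Fin 3) (UnitaryGroup.LocalRing L v)).val.charpoly).discr) ↔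
      IsRegularElt (g.val : GL (Fin 3) (UnitaryGroup.LocalRing L v)) := by
  rw [exists_unit_rel_iff_isUnit_discr, isUnit_charpoly_discr_iff_isRegularElt]

/-! ## §2 The closed form `dg` vanishes exactly off `G^{reg}`, is positive exactly on `G^{reg}`, and is a class function -/

/-- **At a regular `g` the closed form is NON-ZERO** (it equals `√√‖u‖` with `‖u‖ ≠ 0`, the module of a unit). [cite: Rogawski1990, §4.9 p. 54] -/
theorem dgFormula_ne_zero_of_isRegularElt (g : Gqs L v) (hg : IsRegularElt (g.val : GL (Fin 3) (UnitaryGroup.LocalRing L v))) :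
    ((NNReal.sqrt (NNReal.sqrt
        ((∏ w : PlacesOver L v, normAbs (w.1.adicCompletion L) (((g.val : GL (Fin 3) (UnitaryGroup.LocalRing L v)).val.charpoly.discr) w)) *
          ((∏ w : PlacesOver L v, normAbs (w.1.adicCompletion L) (((g.val : GL (Fin 3) (UnitaryGroup.LocalRing L v)).val.det) w)) ^ 2)⁻¹)) : ℝ≥0) : ℝ) ≠ 0 := by
  obtain ⟨u, hu⟩ := (exists_unit_rel_iff_isRegularElt L v g).2 hg
  rw [dgFormula_eq_of_unit_rel L v g u hu, Ne, NNReal.coe_eq_zero, NNReal.sqrt_eq_zero, NNReal.sqrt_eq_zero]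
  exact ((unitModulusChar (UnitaryGroup.LocalRing L v)).toHomUnits u).ne_zero

/-- **The closed form VANISHES EXACTLY OFF `G^{reg}`** — PLAN S9 D5's convention «`D_G = 0` at non-regular `γ`» as an IFF. [cite: Rogawski1990, §4.9 p. 54; §12.5 p. 182] -/
theorem dgFormula_eq_zero_iff_not_isRegularElt (g : Gqs L v) :
    ((NNReal.sqrt (NNReal.sqrt
        ((∏ w : PlacesOver L v, normAbs (w.1.adicCompletion L) (((g.val : GL (Fin 3) (UnitaryGroup.LocalRing L v)).val.charpoly.discr) w)) *
          ((∏ w : PlacesOver L v, normAbs (w.1.adicCompletion L) (((g.val : GL (Fin 3) (UnitaryGroup.LocalRing L v)).val.det) w)) ^ 2)⁻¹)) : ℝ≥0) : ℝ) = 0 ↔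
      ¬ IsRegularElt (g.val : GL (Fin 3) (UnitaryGroup.LocalRing L v)) :=
  ⟨fun h hg => dgFormula_ne_zero_of_isRegularElt L v g hg h,
    fun h => dgFormula_eq_zero_of_not_isUnit_discr L v g (mt (isUnit_charpoly_discr_iff_isRegularElt L v g).1 h)⟩

/-- **The closed form is POSITIVE EXACTLY ON `G^{reg}`.** [cite: Rogawski1990, §4.9 p. 54; §12.5 p. 182] -/
theorem dgFormula_pos_iff_isRegularElt (g : Gqs L v) :
    0 < ((NNReal.sqrt (NNReal.sqrt
        ((∏ w : PlacesOver L v, normAbs (w.1.adicCompletion L) (((g.val : GL (Fin 3) (UnitaryGroup.LocalRing L v)).val.charpoly.discr) w)) *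
          ((∏ w : PlacesOver L v, normAbs (w.1.adicCompletion L) (((g.val : GL (Fin 3) (UnitaryGroup.LocalRing L v)).val.det) w)) ^ 2)⁻¹)) : ℝ≥0) : ℝ) ↔
      IsRegularElt (g.val : GL (Fin 3) (UnitaryGroup.LocalRing L v)) := by
  rw [(NNReal.coe_nonneg _).lt_iff_ne', Ne, dgFormula_eq_zero_iff_not_isRegularElt, not_not]

/-- **The closed form is a CLASS FUNCTION** on `U(Φ₃)(L⁺_v)`: `dg(h g h⁻¹) = dg(g)` (`discr ∘ charpoly` and `det` are conjugation-invariant). [cite: Rogawski1990, §3.1 p. 19; §12.5 p. 182] -/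
theorem dgFormula_conj (g h : Gqs L v) :
    ((NNReal.sqrt (NNReal.sqrt
        ((∏ w : PlacesOver L v, normAbs (w.1.adicCompletion L) ((((h * g * h⁻¹ : Gqs L v).val : GL (Fin 3) (UnitaryGroup.LocalRing L v)).val.charpoly.discr) w)) *
          ((∏ w : PlacesOver L v, normAbs (w.1.adicCompletion L) ((((h * g * h⁻¹ : Gqs L v).val : GL (Fin 3) (UnitaryGroup.LocalRing L v)).val.det) w)) ^ 2)⁻¹)) : ℝ≥0) : ℝ) =
    ((NNReal.sqrt (NNReal.sqrt
        ((∏ w : PlacesOver L v, normAbs (w.1.adicCompletion L) (((g.val : GL (Fin 3) (UnitaryGroup.LocalRing L v)).val.charpoly.discr) w)) *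
          ((∏ w : PlacesOver L v, normAbs (w.1.adicCompletion L) (((g.val : GL (Fin 3) (UnitaryGroup.LocalRing L v)).val.det) w)) ^ 2)⁻¹)) : ℝ≥0) : ℝ) := by
  have hval : ((h * g * h⁻¹ : Gqs L v).val : GL (Fin 3) (UnitaryGroup.LocalRing L v)).val =
      (h.val : GL (Fin 3) (UnitaryGroup.LocalRing L v)).val * (g.val : GL (Fin 3) (UnitaryGroup.LocalRing L v)).val *
        (h.val : GL (Fin 3) (UnitaryGroup.LocalRing L v))⁻¹.val := rfl
  have hdisc : ((h * g * h⁻¹ : Gqs L v).val : GL (Fin 3) (UnitaryGroup.LocalRing L v)).val.charpoly.discr =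
      (g.val : GL (Fin 3) (UnitaryGroup.LocalRing L v)).val.charpoly.discr := by
    rw [hval, charpoly_discr_units_conj]
  have hdet : ((h * g * h⁻¹ : Gqs L v).val : GL (Fin 3) (UnitaryGroup.LocalRing L v)).val.det =
      (g.val : GL (Fin 3) (UnitaryGroup.LocalRing L v)).val.det := by
    rw [hval, Matrix.det_units_conj]
  rw [hdisc, hdet]

end Gqs

/-! ## §3 At a datum with the field equation `hDG : 𝔇.DG = dg` (★ «DG-FIELD★» §3's binder, verbatim) -/

section Datum

variable (L : Type) [Field L] [NumberField L] [IsCMField L] (v : HeightOneSpectrum (𝓞 ↥(maximalRealSubfield L)))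
variable {H : Type} [Group H] [TopologicalSpace H] [IsTopologicalGroup H] [MeasurableSpace H]

/-- **`𝔇.DG γ = 0 ↔ γ` is NOT regular** under the field equation. [cite: Rogawski1990, §4.9 p. 54; §12.5 p. 182] -/
theorem DG_eq_zero_iff_not_isRegularElt
    [MeasurableSpace (Gqs L v)]
    [∀ γ : Gqs L v, MeasurableSpace (Gqs L v ⧸ Subgroup.centralizer ({γ} : Set (Gqs L v)))] [MeasurableSpace (Gqs L v ⧸ Subgroup.center (Gqs L v))]
    (𝔇 : EllipticData (Gqs L v) H)
    (hDG : ∀ g : Gqs L v, 𝔇.DG g =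
      ((NNReal.sqrt (NNReal.sqrt
        ((∏ w : PlacesOver L v, normAbs (w.1.adicCompletion L) (((g.val : GL (Fin 3) (UnitaryGroup.LocalRing L v)).val.charpoly.discr) w)) *
          ((∏ w : PlacesOver L v, normAbs (w.1.adicCompletion L) (((g.val : GL (Fin 3) (UnitaryGroup.LocalRing L v)).val.det) w)) ^ 2)⁻¹)) : ℝ≥0) : ℝ))
    (γ : Gqs L v) : 𝔇.DG γ = 0 ↔ ¬ IsRegularElt (γ.val : GL (Fin 3) (UnitaryGroup.LocalRing L v)) := by
  rw [hDG γ, dgFormula_eq_zero_iff_not_isRegularElt]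

/-- **`0 < 𝔇.DG γ ↔ γ` is regular** under the field equation (so `D_G⁻¹` is legitimate on `G^{reg}`). [cite: Rogawski1990, §4.9 p. 54; §12.5 pp. 182–183] -/
theorem DG_pos_iff_isRegularElt
    [MeasurableSpace (Gqs L v)]
    [∀ γ : Gqs L v, MeasurableSpace (Gqs L v ⧸ Subgroup.centralizer ({γ} : Set (Gqs L v)))] [MeasurableSpace (Gqs L v ⧸ Subgroup.center (Gqs L v))]
    (𝔇 : EllipticData (Gqs L v) H)
    (hDG : ∀ g : Gqs L v, 𝔇.DG g =
      ((NNReal.sqrt (NNReal.sqrt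
        ((∏ w : PlacesOver L v, normAbs (w.1.adicCompletion L) (((g.val : GL (Fin 3) (UnitaryGroup.LocalRing L v)).val.charpoly.discr) w)) *
          ((∏ w : PlacesOver L v, normAbs (w.1.adicCompletion L) (((g.val : GL (Fin 3) (UnitaryGroup.LocalRing L v)).val.det) w)) ^ 2)⁻¹)) : ℝ≥0) : ℝ))
    (γ : Gqs L v) : 0 < 𝔇.DG γ ↔ IsRegularElt (γ.val : GL (Fin 3) (UnitaryGroup.LocalRing L v)) := by
  rw [hDG γ, dgFormula_pos_iff_isRegularElt]

/-- **`𝔇.DG γ ≠ 0` on `𝔇.regG`** under the field equation and COMPAT `𝔇.regG = G^{reg}` (the organ's `hreg`). [cite: Rogawski1990, §4.9 p. 54; §12.5 p. 182] -/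
theorem DG_ne_zero_of_mem_regG
    [MeasurableSpace (Gqs L v)]
    [∀ γ : Gqs L v, MeasurableSpace (Gqs L v ⧸ Subgroup.centralizer ({γ} : Set (Gqs L v)))] [MeasurableSpace (Gqs L v ⧸ Subgroup.center (Gqs L v))]
    (𝔇 : EllipticData (Gqs L v) H)
    (hreg : ∀ γ : Gqs L v, γ ∈ 𝔇.regG ↔ IsRegularElt (γ.val : GL (Fin 3) (UnitaryGroup.LocalRing L v)))
    (hDG : ∀ g : Gqs L v, 𝔇.DG g =
      ((NNReal.sqrt (NNReal.sqrt
        ((∏ w : PlacesOver L v, normAbs (w.1.adicCompletion L) (((g.val : GL (Fin 3) (UnitaryGroup.LocalRing L v)).val.charpoly.discr) w)) *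
          ((∏ w : PlacesOver L v, normAbs (w.1.adicCompletion L) (((g.val : GL (Fin 3) (UnitaryGroup.LocalRing L v)).val.det) w)) ^ 2)⁻¹)) : ℝ≥0) : ℝ))
    {γ : Gqs L v} (hγ : γ ∈ 𝔇.regG) : 𝔇.DG γ ≠ 0 :=
  ((DG_pos_iff_isRegularElt L v 𝔇 hDG γ).2 ((hreg γ).1 hγ)).ne'

/-- **`𝔇.DG γ = 0` off `𝔇.regG`** under the field equation and COMPAT (PLAN S9 D5's convention, from `hreg`). [cite: Rogawski1990, §4.9 p. 54; §12.5 p. 182] -/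
theorem DG_eq_zero_of_not_mem_regG
    [MeasurableSpace (Gqs L v)]
    [∀ γ : Gqs L v, MeasurableSpace (Gqs L v ⧸ Subgroup.centralizer ({γ} : Set (Gqs L v)))] [MeasurableSpace (Gqs L v ⧸ Subgroup.center (Gqs L v))]
    (𝔇 : EllipticData (Gqs L v) H)
    (hreg : ∀ γ : Gqs L v, γ ∈ 𝔇.regG ↔ IsRegularElt (γ.val : GL (Fin 3) (UnitaryGroup.LocalRing L v)))
    (hDG : ∀ g : Gqs L v, 𝔇.DG g =
      ((NNReal.sqrt (NNReal.sqrt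
        ((∏ w : PlacesOver L v, normAbs (w.1.adicCompletion L) (((g.val : GL (Fin 3) (UnitaryGroup.LocalRing L v)).val.charpoly.discr) w)) *
          ((∏ w : PlacesOver L v, normAbs (w.1.adicCompletion L) (((g.val : GL (Fin 3) (UnitaryGroup.LocalRing L v)).val.det) w)) ^ 2)⁻¹)) : ℝ≥0) : ℝ))
    {γ : Gqs L v} (hγ : γ ∉ 𝔇.regG) : 𝔇.DG γ = 0 :=
  (DG_eq_zero_iff_not_isRegularElt L v 𝔇 hDG γ).2 fun h => hγ ((hreg γ).2 h)

/-- **`𝔇.DG` is a CLASS FUNCTION** under the field equation: `𝔇.DG (h γ h⁻¹) = 𝔇.DG γ`. [cite: Rogawski1990, §3.1 p. 19; §12.5 p. 182] -/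
theorem DG_conj
    [MeasurableSpace (Gqs L v)]
    [∀ γ : Gqs L v, MeasurableSpace (Gqs L v ⧸ Subgroup.centralizer ({γ} : Set (Gqs L v)))] [MeasurableSpace (Gqs L v ⧸ Subgroup.center (Gqs L v))]
    (𝔇 : EllipticData (Gqs L v) H)
    (hDG : ∀ g : Gqs L v, 𝔇.DG g =
      ((NNReal.sqrt (NNReal.sqrt
        ((∏ w : PlacesOver L v, normAbs (w.1.adicCompletion L) (((g.val : GL (Fin 3) (UnitaryGroup.LocalRing L v)).val.charpoly.discr) w)) *
          ((∏ w : PlacesOver L v, normAbs (w.1.adicCompletion L) (((g.val : GL (Fin 3) (UnitaryGroup.LocalRing L v)).val.det) w)) ^ 2)⁻¹)) : ℝ≥0) : ℝ))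
    (γ h : Gqs L v) : 𝔇.DG (h * γ * h⁻¹) = 𝔇.DG γ := by
  rw [hDG, hDG, dgFormula_conj]

end Datum

end Summit.HodgeConjecture.HodgeConjecture.Cruxes.H413.F0P3cStCharTSDGFieldReg

end
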